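import Literature.NumberTheory.ConnesConsani2021.ProlateProjections
import Literature.NumberTheory.LFunctions.ProlateEigenvalueLegendreBounds
import HarnessLib

/-!
# Identifying certified prolate members BY INDEX from the ordering of their eigenvalues

RH-FREE corpus literature (label, line 1): Sturm–Liouville bookkeeping for Slepian's prolate functions;
nothing in this file mentions `ζ`, the critical strip or RH, and nothing here bears on the truth of RH.
bears_on (cell rh-crit, corpus C1): apex input (C) — route «ConnesConsaniSemilocal» item K3
`WindowSpectralBound` (stmt 19306): the (deferred-then-staffed, director-rh 09:43:03Z) in-kernel (E-a)
certificate encloses finitely many even prolate functions INDEX-FREE (a Frobenius solution with a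
certified even eigenvalue `χ` is `prolateFun k` for SOME `k`, gm-t16's `isProlateFunction_frobEvenExt`),
while the frame `section6_enclosures_of_panels` (`ArchKernelL1Certificate.lean`) and the explicit
tail (seat t15 g3, option (iv)) are indexed by `n < N₁` / `n ≥ N₁`.  This file closes that gap with
NO zero counting: ORDER the certified eigenvalues and cap the top one.

## What is here (all PROVED; 0 definitions, 0 named facts)

* `IsProlateFunction.index_lt_of_eigen_lt_cast` — from [Wang 2010, Lemma 2.2] (`lt_eigen`,
  `χ > n(n+1)`): an even member `h_{2k}` with eigenvalue `χ < 2N(2N+1)` has `k < N`;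
* **`prolate_index_eq_of_eigen_strictMono`** — if `u_0, …, u_{N−1}` are even prolate functions
  (`IsProlateFunction 1 (2k_j) u_j`) with eigenvalues `χ_0 < χ_1 < … < χ_{N−1} < 2N(2N+1)`, then
  `k_j = j` for every `j < N` (Sturm's count `IsProlateFunction.succ_le_of_eigen_lt` makes `j ↦ k_j`
  strictly increasing; the cap gives `k_{N−1} ≤ N−1`);
* **`eq_prolateFun_of_eigen_strictMono`** — hence `u_j = prolateFun j` (uniqueness,
  `eq_prolateFun_of_isProlateFunction`): the certified members ARE the modes `0, …, N−1`.

Sources: A. Connes, C. Consani, Selecta Math. 27 (2021) 77 = arXiv:2006.13771 [bib `ConnesConsani2021`],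
§4 p. 16 (the even prolate family `ψ_n = PS_{2n,0}`, its eigenvalues); L.-L. Wang, Math. Comp. 79
(2010) Lemma 2.2 [bib `WangLL2010`]; Sturm comparison: P. Hartman, ODE, Ch. XI §4 Thm 4.1.

WHAT THIS FILE IS NOT: a certificate (the eigenvalue brackets are Tier-2 data), or anything about RH.
-/

noncomputable section

open Real Set

namespace Literature.NumberTheory.ConnesConsani2021

open Literature.NumberTheory.LFunctions

/-- RH-FREE. **Index cap from Wang's lower bound**: an even prolate function `h_{2k,1}` whose
eigenvalue is `< 2N(2N+1)` has `k < N` (`2k(2k+1) < χ`, [Wang 2010, Lemma 2.2]).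
[cite: WangLL2010, Lemma 2.2; ConnesConsani2021, §4 p. 16 (arXiv p0016:L17–L36)] -/
theorem _root_.Literature.NumberTheory.LFunctions.IsProlateFunction.index_lt_of_eigen_lt
    {k N : ℕ} {u : ℝ → ℝ} (hu : IsProlateFunction 1 (2 * k) u) {χ : ℝ}
    (hχ : ∀ x ∈ Ioo (-1 : ℝ) 1,
      -(deriv (fun y ↦ ((1 : ℝ) ^ 2 - y ^ 2) * deriv u y) x) + (2 * π * 1 * x) ^ 2 * u x = χ * u x)
    (htop : χ < 2 * (N : ℝ) * (2 * N + 1)) : k < N := by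
  have hlt : ((2 * k : ℕ) : ℝ) * ((2 * k : ℕ) + 1) < χ := hu.lt_eigen hχ
  push_cast at hlt
  by_contra hle
  push Not at hle
  have hNk : (N : ℝ) ≤ k := by exact_mod_cast hle
  have hN0 : (0 : ℝ) ≤ N := Nat.cast_nonneg N
  nlinarith

/-- RH-FREE. **Identification by ordering**: even prolate functions `u_j = h_{2k_j,1}` (`j < N`) with
strictly increasing eigenvalues `χ_0 < … < χ_{N−1}` and `χ_{N−1} < 2N(2N+1)` have `k_j = j`.  Sturm's
count (`IsProlateFunction.succ_le_of_eigen_lt`: a larger eigenvalue has strictly more zeros) makes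
`j ↦ k_j` strictly increasing, so `k_j + (N−1−j) ≤ k_{N−1} ≤ N−1`, while `j ≤ k_j`.
[cite: Hartman2002, Ch. XI §4 Thm 4.1; WangLL2010, Lemma 2.2; ConnesConsani2021, §4 p. 16 (arXiv p0016:L17–L36)] -/
theorem prolate_index_eq_of_eigen_strictMono {N : ℕ} {u : ℕ → ℝ → ℝ} {k : ℕ → ℕ} {χ : ℕ → ℝ}
    (hu : ∀ j < N, IsProlateFunction 1 (2 * k j) (u j))
    (hχ : ∀ j < N, ∀ x ∈ Ioo (-1 : ℝ) 1,
      -(deriv (fun y ↦ ((1 : ℝ) ^ 2 - y ^ 2) * deriv (u j) y) x) + (2 * π * 1 * x) ^ 2 * u j x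
        = χ j * u j x)
    (hmono : ∀ j, j + 1 < N → χ j < χ (j + 1))
    (htop : ∀ j < N, χ j < 2 * (N : ℝ) * (2 * N + 1)) :
    ∀ j < N, k j = j := by
  -- strict monotonicity of the indices
  have hstrict : ∀ j, j + 1 < N → k j < k (j + 1) := by
    intro j hj
    have h := (hu j (by omega)).succ_le_of_eigen_lt (hu (j + 1) hj) (hχ j (by omega)) (hχ (j + 1) hj)
      (hmono j hj)
    omega
  -- lower bound `j ≤ k j`
  have hlow : ∀ j < N, j ≤ k j := by
    intro j
    induction j with
    | zero => intro _; exact Nat.zero_le _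
    | succ i ih =>
      intro hi
      have h1 := ih (by omega)
      have h2 := hstrict i hi
      omega
  -- upper bound: `k j + (N - 1 - j) ≤ k (N - 1)`
  have hup : ∀ i < N, k (N - 1 - i) + i ≤ k (N - 1) := by
    intro i
    induction i with
    | zero => intro _; simp
    | succ i ih =>
      intro hi
      have h1 := ih (by omega)
      have h2 := hstrict (N - 1 - (i + 1)) (by omega)
      have e : N - 1 - (i + 1) + 1 = N - 1 - i := by omega
      rw [e] at h2
      omega
  -- the cap on the top index
  intro j hj
  have hN : 0 < N := by omega
  have htopk : k (N - 1) < N :=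
    (hu (N - 1) (by omega)).index_lt_of_eigen_lt (hχ (N - 1) (by omega)) (htop (N - 1) (by omega))
  have h1 := hlow j hj
  have h2 := hup (N - 1 - j) (by omega)
  have e : N - 1 - (N - 1 - j) = j := by omega
  rw [e] at h2
  omega

/-- RH-FREE. **The certified members are the modes `0, …, N−1`**: under the hypotheses of
`prolate_index_eq_of_eigen_strictMono`, `u_j = prolateFun j` for every `j < N` (uniqueness of the
even prolate function with a given zero count, `eq_prolateFun_of_isProlateFunction`).  This is how an
INDEX-FREE kernel certificate (Frobenius solutions with certified even eigenvalues in increasing,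
disjoint brackets) feeds the index-wise frame `section6_enclosures_of_panels` and an index-wise tail.
[cite: ConnesConsani2021, §4 p. 16 (arXiv p0016:L17–L36); WangLL2010, Lemma 2.2; Hartman2002, Ch. XI §4 Thm 4.1] -/
theorem eq_prolateFun_of_eigen_strictMono {N : ℕ} {u : ℕ → ℝ → ℝ} {k : ℕ → ℕ} {χ : ℕ → ℝ}
    (hu : ∀ j < N, IsProlateFunction 1 (2 * k j) (u j))
    (hχ : ∀ j < N, ∀ x ∈ Ioo (-1 : ℝ) 1,
      -(deriv (fun y ↦ ((1 : ℝ) ^ 2 - y ^ 2) * deriv (u j) y) x) + (2 * π * 1 * x) ^ 2 * u j x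
        = χ j * u j x)
    (hmono : ∀ j, j + 1 < N → χ j < χ (j + 1))
    (htop : ∀ j < N, χ j < 2 * (N : ℝ) * (2 * N + 1)) :
    ∀ j < N, u j = prolateFun j := by
  intro j hj
  have hk := prolate_index_eq_of_eigen_strictMono hu hχ hmono htop j hj
  have h := hu j hj
  rw [hk] at h
  exact eq_prolateFun_of_isProlateFunction h

/-- RH-FREE. Existential-index form (the shape gm-t16's `isProlateFunction_frobEvenExt` delivers:
`∃ k, IsProlateFunction 1 (2k) u`): members with strictly increasing certified eigenvalues capped by
`2N(2N+1)` are `prolateFun 0, …, prolateFun (N−1)` in order.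
[cite: ConnesConsani2021, §4 p. 16 (arXiv p0016:L17–L36); WangLL2010, Lemma 2.2] -/
theorem eq_prolateFun_of_exists_index_of_eigen_strictMono {N : ℕ} {u : ℕ → ℝ → ℝ} {χ : ℕ → ℝ}
    (hu : ∀ j < N, ∃ k : ℕ, IsProlateFunction 1 (2 * k) (u j))
    (hχ : ∀ j < N, ∀ x ∈ Ioo (-1 : ℝ) 1,
      -(deriv (fun y ↦ ((1 : ℝ) ^ 2 - y ^ 2) * deriv (u j) y) x) + (2 * π * 1 * x) ^ 2 * u j x
        = χ j * u j x)
    (hmono : ∀ j, j + 1 < N → χ j < χ (j + 1))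
    (htop : ∀ j < N, χ j < 2 * (N : ℝ) * (2 * N + 1)) :
    ∀ j < N, u j = prolateFun j := by
  classical
  -- choose the indices
  let k : ℕ → ℕ := fun j ↦ if h : j < N then (hu j h).choose else 0
  have hk : ∀ j < N, IsProlateFunction 1 (2 * k j) (u j) := by
    intro j hj
    simp only [k, dif_pos hj]
    exact (hu j hj).choose_spec
  exact eq_prolateFun_of_eigen_strictMono hk hχ hmono htop

end Literature.NumberTheory.ConnesConsani2021

end
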